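import Summits.QuantumFields.YangMills.Theorems.BalabanLadderROTWardShapeProfile
import HarnessLib

/-!
# Crux `ROT` (stmt-QuantumFields-20042), infinitesimal Ward route (lane B) — X: weight-side Taylor expansion of the lattice angular momentum

Helper file (`--supports stmt-QuantumFields-20042`, lane `ym-rot-20042-p2`).  For a two-point weight of hyperscaling form
`W(x₀,x₁) = a⁸ h(a(x₀ − x₁))` with a smooth profile `h` whose derivative is `K`-Lipschitz, the lattice angular momentum of the weight is,
to leading order, the weight built on the angular derivative of the profile:
`|(𝓛 W)(x) − a⁸ (∂_θ h)(a(x₀ − x₁))| ≤ 4 K a¹⁰ ‖x‖∞` (`abs_latAngMom_profile_sub_le`; the first-order terms of the four backward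
differences reassemble `∂_θ`, the second-order Taylor remainders are `≤ K a²` each, weighted by the coordinates `|xᵢ^μ| ≤ ‖x‖`).
Auxiliary: `exists_lipschitz_fderiv_real`, `norm_taylor_two_le_real` (real functions on `ℝ⁴`), the relative coordinate of shifted
multi-sites (`zdiff_sub_unitVec_zero/one`, `zdiff_apply`).

Pure calculus over the lane's lattice vocabulary (`latAngMom`, `bdiff`, `scaleSite`).  No fact, no sorry.
-/

set_option autoImplicit false

noncomputable section

open scoped SchwartzMap BigOperators RealInnerProductSpace ContDiff
open MeasureTheory Filter Topology Metric
open Literature.MathematicalPhysics.QuantumFieldTheory Literature.MathematicalPhysics.QuantumLattice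
open Literature.MathematicalPhysics.AQFT
open Literature.Probability.LatticeModels (box Site mem_box)
open Summit.QuantumFields.YangMills.Cruxes.OSLegsFromFemtoAndGap.DlrCollarTransfer (MomentBounds)
open Summit.QuantumFields.YangMills.Cruxes.OSLegsAtWeakCouplingC.Sketch (Separated SmallDiam)
open Summit.QuantumFields.YangMills.Cruxes.OSLegsAtWeakCouplingC.Y2Bridge (LatticeRotWard)
open Summit.QuantumFields.YangMills.Cruxes.OSLegsAtWeakCouplingC.Y2Bridge.King (KingClass)
open Summit.QuantumFields.YangMills.Theorems.OSLegsFromFemtoAndGap (torusMoment mul_norm_le_norm_smul_siteToE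
  norm_smul_siteToE_sub_le abs_coord_le_norm_siteToE siteToE_sub)
open Summit.QuantumFields.YangMills.Theorems.NPointIsotropy.Negative (E4)

namespace Summit.QuantumFields.YangMills.Theorems.ROT.Ward

/-! ## Weight-side Taylor expansion: `(𝓛 W)(x) = a⁸ (∂_θ h)(a z) + O(a¹⁰‖x‖)` for `W = a⁸ h(a(x₀ − x₁))` -/

section WeightTaylor

/-- Lipschitz derivative of a smooth compactly supported real function on `ℝ⁴`. -/
theorem exists_lipschitz_fderiv_real (f : E4 → ℝ) (hf : ContDiff ℝ ∞ f) (hc : HasCompactSupport f) :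
    ∃ K : ℝ, 0 ≤ K ∧ ∀ y₁ y₂ : E4, ‖fderiv ℝ f y₁ - fderiv ℝ f y₂‖ ≤ K * ‖y₁ - y₂‖ := by
  have h1 : ContDiff ℝ 1 (fderiv ℝ f) := hf.fderiv_right (m := 1) (by decide)
  obtain ⟨K, hK⟩ := (h1.continuous_fderiv one_ne_zero).bounded_above_of_compact_support ((hc.fderiv ℝ).fderiv ℝ)
  have hK0 : 0 ≤ K := (norm_nonneg _).trans (hK 0)
  refine ⟨K, hK0, fun y₁ y₂ => ?_⟩
  exact Convex.norm_image_sub_le_of_norm_fderiv_le (f := fderiv ℝ f)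
    (fun y _ => (h1.differentiable one_ne_zero).differentiableAt) (fun y _ => hK y) convex_univ (Set.mem_univ y₂)
    (Set.mem_univ y₁)

/-- Second-order Taylor remainder for a differentiable real function on `ℝ⁴` with `K`-Lipschitz derivative. -/
theorem norm_taylor_two_le_real (f : E4 → ℝ) (hf : Differentiable ℝ f) {K : ℝ} (hK0 : 0 ≤ K)
    (hK : ∀ y₁ y₂ : E4, ‖fderiv ℝ f y₁ - fderiv ℝ f y₂‖ ≤ K * ‖y₁ - y₂‖) (y v : E4) :
    ‖f (y + v) - f y - fderiv ℝ f y v‖ ≤ K * ‖v‖ ^ 2 := by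
  set H : ℝ → ℝ := fun t => f (y + t • v) - t • fderiv ℝ f y v with hH
  have hderiv : ∀ t : ℝ, HasDerivAt H (fderiv ℝ f (y + t • v) v - fderiv ℝ f y v) t := by
    intro t
    have h1 : HasDerivAt (fun t : ℝ => y + t • v) v t := by
      simpa using ((hasDerivAt_id t).smul_const v).const_add y
    have h2 := ((hf (y + t • v)).hasFDerivAt).comp_hasDerivAt t h1
    have h3 : HasDerivAt (fun t : ℝ => t • fderiv ℝ f y v) (fderiv ℝ f y v) t := by
      simpa using (hasDerivAt_id t).smul_const (fderiv ℝ f y v)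
    exact h2.sub h3
  have hbound : ∀ t ∈ Set.Icc (0 : ℝ) 1, ‖fderiv ℝ f (y + t • v) v - fderiv ℝ f y v‖ ≤ K * ‖v‖ ^ 2 := by
    intro t ht
    refine (ContinuousLinearMap.le_opNorm (fderiv ℝ f (y + t • v) - fderiv ℝ f y) v).trans ?_
    have h1 := hK (y + t • v) y
    rw [add_sub_cancel_left, norm_smul, Real.norm_eq_abs, abs_of_nonneg ht.1] at h1
    calc ‖fderiv ℝ f (y + t • v) - fderiv ℝ f y‖ * ‖v‖ ≤ (K * (t * ‖v‖)) * ‖v‖ := by gcongr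
      _ ≤ (K * (1 * ‖v‖)) * ‖v‖ := by gcongr; exact ht.2
      _ = K * ‖v‖ ^ 2 := by ring
  have key := Convex.norm_image_sub_le_of_norm_hasDerivWithin_le (fun t _ => (hderiv t).hasDerivWithinAt) hbound
    (convex_Icc 0 1) (Set.left_mem_Icc.2 zero_le_one) (Set.right_mem_Icc.2 zero_le_one)
  have hH1 : H 1 - H 0 = f (y + v) - f y - fderiv ℝ f y v := by
    simp only [hH, one_smul, zero_smul, add_zero, sub_zero]
    ring
  rw [← hH1]
  simpa using key

/-- Scaling a multi-site shifted DOWN by a unit lattice vector. -/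
theorem scaleSite_sub_unitVec {n : ℕ} (a : ℝ) (x : Fin n → Site 4) (i : Fin n) (μ : Fin 4) :
    scaleSite a (x - unitVec i μ) = scaleSite a x - a • contUnitVec i μ := by
  have h := scaleSite_add_unitVec a (x - unitVec i μ) i μ
  rw [sub_add_cancel] at h
  rw [h, add_sub_cancel_right]

/-- The slot-`i` value of the continuum unit vector. -/
theorem contUnitVec_apply_same {n : ℕ} (i : Fin n) (μ : Fin 4) : contUnitVec i μ i = EuclideanSpace.single μ 1 := by
  simp [contUnitVec]

/-- The relative coordinate of a two-slot multi-site shifted down in slot `0`. -/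
theorem zdiff_sub_unitVec_zero (a : ℝ) (x : Fin 2 → Site 4) (μ : Fin 4) :
    scaleSite a (x - unitVec 0 μ) 0 - scaleSite a (x - unitVec 0 μ) 1 =
      (scaleSite a x 0 - scaleSite a x 1) - a • EuclideanSpace.single μ 1 := by
  rw [scaleSite_sub_unitVec]
  simp only [Pi.sub_apply, Pi.smul_apply, contUnitVec_apply_same, contUnitVec_apply_of_ne (show (1 : Fin 2) ≠ 0 by decide)]
  simp only [smul_zero, sub_zero]
  abel

/-- The relative coordinate of a two-slot multi-site shifted down in slot `1`. -/
theorem zdiff_sub_unitVec_one (a : ℝ) (x : Fin 2 → Site 4) (μ : Fin 4) :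
    scaleSite a (x - unitVec 1 μ) 0 - scaleSite a (x - unitVec 1 μ) 1 =
      (scaleSite a x 0 - scaleSite a x 1) + a • EuclideanSpace.single μ 1 := by
  rw [scaleSite_sub_unitVec]
  simp only [Pi.sub_apply, Pi.smul_apply, contUnitVec_apply_same, contUnitVec_apply_of_ne (show (0 : Fin 2) ≠ 1 by decide)]
  simp only [smul_zero, sub_zero]
  abel

/-- Coordinates of the relative position: `(a x₀ − a x₁)^ν = a (x₀^ν − x₁^ν)`. -/
theorem zdiff_apply (a : ℝ) (x : Fin 2 → Site 4) (ν : Fin 4) :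
    (scaleSite a x 0 - scaleSite a x 1) ν = a * ((x 0 ν : ℝ) - (x 1 ν : ℝ)) := by
  rw [PiLp.sub_apply, scaleSite_apply, scaleSite_apply]
  ring

/-- **Weight-side Taylor expansion.**  For the two-point weight `W(x) = a⁸ h(a(x₀ − x₁))` with `dh` `K`-Lipschitz,
`|(𝓛 W)(x) − a⁸ (∂_θ h)(a(x₀ − x₁))| ≤ 4 K a¹⁰ ‖x‖∞`: the lattice angular momentum of the weight IS, to leading order, the weight
built on the angular derivative of the profile. -/
theorem abs_latAngMom_profile_sub_le (h : E4 → ℝ) (hdiff : Differentiable ℝ h) {K : ℝ} (hK0 : 0 ≤ K)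
    (hK : ∀ y₁ y₂ : E4, ‖fderiv ℝ h y₁ - fderiv ℝ h y₂‖ ≤ K * ‖y₁ - y₂‖) {a : ℝ} (ha : 0 < a) (x : Fin 2 → Site 4) :
    |latAngMom (fun x : Fin 2 → Site 4 => a ^ 8 * h (scaleSite a x 0 - scaleSite a x 1)) x -
        a ^ 8 * angDeriv h (scaleSite a x 0 - scaleSite a x 1)| ≤ 4 * K * a ^ 10 * ‖x‖ := by
  set z : E4 := scaleSite a x 0 - scaleSite a x 1 with hz
  set e0 : E4 := EuclideanSpace.single 0 1 with he0
  set e1 : E4 := EuclideanSpace.single 1 1 with he1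
  -- the four Taylor remainders
  set R1m : ℝ := h (z + -(a • e1)) - h z - fderiv ℝ h z (-(a • e1)) with hR1m
  set R0m : ℝ := h (z + -(a • e0)) - h z - fderiv ℝ h z (-(a • e0)) with hR0m
  set R1p : ℝ := h (z + a • e1) - h z - fderiv ℝ h z (a • e1) with hR1p
  set R0p : ℝ := h (z + a • e0) - h z - fderiv ℝ h z (a • e0) with hR0p
  have hne1 : ‖(a • e1 : E4)‖ = a := by rw [norm_smul, he1, PiLp.norm_single]; simp [abs_of_pos ha]
  have hne0 : ‖(a • e0 : E4)‖ = a := by rw [norm_smul, he0, PiLp.norm_single]; simp [abs_of_pos ha]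
  have b1m : |R1m| ≤ K * a ^ 2 := by
    rw [hR1m, ← Real.norm_eq_abs]
    have := norm_taylor_two_le_real h hdiff hK0 hK z (-(a • e1)); rwa [norm_neg, hne1] at this
  have b0m : |R0m| ≤ K * a ^ 2 := by
    rw [hR0m, ← Real.norm_eq_abs]
    have := norm_taylor_two_le_real h hdiff hK0 hK z (-(a • e0)); rwa [norm_neg, hne0] at this
  have b1p : |R1p| ≤ K * a ^ 2 := by
    rw [hR1p, ← Real.norm_eq_abs]
    have := norm_taylor_two_le_real h hdiff hK0 hK z (a • e1); rwa [hne1] at this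
  have b0p : |R0p| ≤ K * a ^ 2 := by
    rw [hR0p, ← Real.norm_eq_abs]
    have := norm_taylor_two_le_real h hdiff hK0 hK z (a • e0); rwa [hne0] at this
  -- the exact algebra: the first-order terms cancel against `a⁸ ∂_θ h`
  have hang : angDeriv h z = z 0 * fderiv ℝ h z e1 - z 1 * fderiv ℝ h z e0 := by
    simp only [angDeriv, rotVec, he0, he1, map_sub, map_smul, smul_eq_mul]
  have hz0 : z 0 = a * ((x 0 0 : ℝ) - (x 1 0 : ℝ)) := zdiff_apply a x 0
  have hz1 : z 1 = a * ((x 0 1 : ℝ) - (x 1 1 : ℝ)) := zdiff_apply a x 1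
  have hL : latAngMom (fun x : Fin 2 → Site 4 => a ^ 8 * h (scaleSite a x 0 - scaleSite a x 1)) x =
      a ^ 8 * ((x 0 0 : ℝ) * (h z - h (z + -(a • e1))) - (x 0 1 : ℝ) * (h z - h (z + -(a • e0))) +
        ((x 1 0 : ℝ) * (h z - h (z + a • e1)) - (x 1 1 : ℝ) * (h z - h (z + a • e0)))) := by
    simp only [latAngMom, bdiff, Fin.sum_univ_two, zdiff_sub_unitVec_zero, zdiff_sub_unitVec_one, ← hz, ← he0, ← he1,
      ← sub_eq_add_neg]
    ring
  have hkey : latAngMom (fun x : Fin 2 → Site 4 => a ^ 8 * h (scaleSite a x 0 - scaleSite a x 1)) x - a ^ 8 * angDeriv h z =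
      a ^ 8 * (-(x 0 0 : ℝ) * R1m + (x 0 1 : ℝ) * R0m - (x 1 0 : ℝ) * R1p + (x 1 1 : ℝ) * R0p) := by
    rw [hL, hang, hz0, hz1, hR1m, hR0m, hR1p, hR0p]
    simp only [map_neg, map_smul, smul_eq_mul]
    ring
  rw [hkey]
  -- sizes
  have hc : ∀ (i : Fin 2) (ν : Fin 4), |(x i ν : ℝ)| ≤ ‖x‖ := by
    intro i ν
    have h1 : (‖x i ν‖ : ℝ) ≤ ‖x‖ := (norm_le_pi_norm (x i) ν).trans (norm_le_pi_norm x i)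
    rwa [Int.norm_eq_abs] at h1
  rw [abs_mul, abs_of_nonneg (by positivity : (0 : ℝ) ≤ a ^ 8)]
  have htri : |-(x 0 0 : ℝ) * R1m + (x 0 1 : ℝ) * R0m - (x 1 0 : ℝ) * R1p + (x 1 1 : ℝ) * R0p| ≤
      ‖x‖ * (K * a ^ 2) + ‖x‖ * (K * a ^ 2) + ‖x‖ * (K * a ^ 2) + ‖x‖ * (K * a ^ 2) := by
    have t1 : |-(x 0 0 : ℝ) * R1m| ≤ ‖x‖ * (K * a ^ 2) := by
      rw [abs_mul, abs_neg]; exact mul_le_mul (hc 0 0) b1m (abs_nonneg _) (norm_nonneg _)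
    have t2 : |(x 0 1 : ℝ) * R0m| ≤ ‖x‖ * (K * a ^ 2) := by
      rw [abs_mul]; exact mul_le_mul (hc 0 1) b0m (abs_nonneg _) (norm_nonneg _)
    have t3 : |(x 1 0 : ℝ) * R1p| ≤ ‖x‖ * (K * a ^ 2) := by
      rw [abs_mul]; exact mul_le_mul (hc 1 0) b1p (abs_nonneg _) (norm_nonneg _)
    have t4 : |(x 1 1 : ℝ) * R0p| ≤ ‖x‖ * (K * a ^ 2) := by
      rw [abs_mul]; exact mul_le_mul (hc 1 1) b0p (abs_nonneg _) (norm_nonneg _)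
    calc _ ≤ |-(x 0 0 : ℝ) * R1m + (x 0 1 : ℝ) * R0m - (x 1 0 : ℝ) * R1p| + |(x 1 1 : ℝ) * R0p| := abs_add_le _ _
      _ ≤ (|-(x 0 0 : ℝ) * R1m + (x 0 1 : ℝ) * R0m| + |(x 1 0 : ℝ) * R1p|) + |(x 1 1 : ℝ) * R0p| := by
          gcongr; exact abs_sub _ _
      _ ≤ ((|-(x 0 0 : ℝ) * R1m| + |(x 0 1 : ℝ) * R0m|) + |(x 1 0 : ℝ) * R1p|) + |(x 1 1 : ℝ) * R0p| := by
          gcongr; exact abs_add_le _ _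
      _ ≤ _ := by linarith
  calc a ^ 8 * |-(x 0 0 : ℝ) * R1m + (x 0 1 : ℝ) * R0m - (x 1 0 : ℝ) * R1p + (x 1 1 : ℝ) * R0p|
      ≤ a ^ 8 * (‖x‖ * (K * a ^ 2) + ‖x‖ * (K * a ^ 2) + ‖x‖ * (K * a ^ 2) + ‖x‖ * (K * a ^ 2)) := by gcongr
    _ = 4 * K * a ^ 10 * ‖x‖ := by ring

end WeightTaylor

end Summit.QuantumFields.YangMills.Theorems.ROT.Ward

end
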